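import Literature.NumberTheory.NumberFields.RayClassFieldLocalTowerNormUnramified
import Literature.RingTheory.DedekindDomain.PrincipalUnitPowerLevel
import HarnessLib

/-!
# THE ORDER OF THE FROBENIUS OF `v` IN `Gal(K(𝔤v'^n)/K)` GROWS BY `p` PER LEVEL: `d·p^{n−m} ∣ ord Frob_v(K(𝔤v'^n))` from ONE
# global element `α ≡ 1 mod 𝔤`, `(α) = 𝔭_v^f`, of exact `v'`-level `m` — hence the INERT hypothesis of the two-variable (c)-tower
# (de Shalit II.1.9 / II.1.10 / II.4.14; Serre, *Cours d'arithmétique* II §3.1)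

For the two-variable towers `K(𝔤v'^{i+1}v^{k+1})` of de Shalit II.4.14 at a prime `v` (auxiliary prime `v' ≠ v` above the rational prime `p`,
ABSOLUTELY UNRAMIFIED: `p ∈ v' ∖ v'²`) the (c)-capstone (`Summit…ColemanCoinvariantEllipticUnitsLiftable…`) carries the hypothesis INERT: «every
`τ ∈ Γ_{K_v}` fixing `ι K(𝔤v'^{i+1})` fixes the unramified layer `E_{i+c}` of degree `d·p^{i+c}`», which by
`RayClassFieldLocalTowerNormUnramified.mem_fixingSubgroup_of_forall_smul_absClosureEmbedding_eq_of_finrank_dvd_orderOf` follows from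
**`d·p^{i+c} ∣ ord Frob_v(K(𝔤v'^{i+1}))`**.  THIS file supplies that divisibility from ONE arithmetic datum: an `α ∈ 𝓞_K`, `α ≠ 0`,
`α ≡ 1 mod 𝔤`, with `(α) = 𝔭_v^f` (so `Frob_v^f = ((α), ·)` on every `K(𝔤v'^n)`), whose distance to `1` at `v'` is EXACTLY `m` (`m ≥ 1`,
`m ≥ 2` if `p = 2`).  Then `((α^j), K(𝔤v'^n)/K) = 1 ↔ α^j ≡ 1 mod v'^n` (`RayClassFieldAdicCharacterPrincipal`, `w_𝔤 = 1`) and lifting the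
exponent (`PrincipalUnitPowerLevel.pow_sub_one_mem_pow_iff`: `α^j − 1 ∈ v'^{m+t} ↔ p^t ∣ j`) give:

* `artinSymbol_asIdeal_pow` (`(Frob_v)^f = artinSymbol 𝔭_v^f`), `galFrob_pow_mul_eq_artinHom_pow` (`Frob_v^{f·j} = ((α^j), K(𝔤v'^n)/K)`);
* ★★ `pow_prime_dvd_of_galFrob_pow_eq_one` / **`pow_prime_dvd_orderOf_galFrob`** — `Frob_v^j = 1` on `K(𝔤v'^n)`, `n ≥ m` ⟹ `p^{n−m} ∣ j`; hence
  `p^{n−m} ∣ ord Frob_v(K(𝔤v'^n))`;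
* ★ `orderOf_galFrob_dvd_of_le` — `ord Frob_v(K(𝔪₁)) ∣ ord Frob_v(K(𝔪₂))` for `K(𝔪₁) ≤ K(𝔪₂)` (the global Artin element of `𝔭_v` restricts to
  both); so a prime-to-`p` factor `d ∣ ord Frob_v(K(𝔤))` persists: ★★ **`mul_pow_prime_dvd_orderOf_galFrob`** — `d·p^{n−m} ∣ ord Frob_v(K(𝔤v'^n))`;
* ★★ `mul_pow_prime_dvd_orderOf_frob_idelic` — the same for the idelic Frobenius `[⟨π⟩_v, K]|_{K(𝔤v'^n)}` of a uniformiser `π` of `K_v`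
  (`abRestrict_ideleArtinMap_rayClassField_localUnits`), the form consumed by the INERT criterion above;
* §2 ★★ `pow_prime_dvd_of_galFrob_pow_eq_one_of_pow_level` / `mul_pow_prime_succ_dvd_orderOf_galFrob_of_pow_level` /
  `…_frob_idelic_of_pow_level` — the SHARP form `d·p^{n−m+1} ∣ ord Frob_v(K(𝔤v'^n))` for `α` of any level `ℓ ≥ 1` whose `p`-th power has exact
  level `m` (needed at `p = 2`, `ℓ = 1`, where Serre's lemma starts only at `α²`: e.g. `K = ℚ(√−7)`, `α = π³ ≡ 3 mod 8`, `α² ≡ 9 mod 16`).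

Theorems only; no `sorry`; no definitions.

## References
* [deShalit1987] E. de Shalit, *Iwasawa theory of elliptic curves with complex multiplication* (1987), II.1.9 (p. 43), II.1.10 (p. 39),
  II.4.14 (p. 71), II.4.17 (p. 78).
* [Serre1973CourseArithmetic] J.-P. Serre, *A Course in Arithmetic* (1973), Ch. II §3.1.
* [NeukirchANT1999] J. Neukirch, *Algebraic Number Theory* (1999), Ch. VI §7 Thm. (7.1), Cor. (7.3).
-/

noncomputable section

open NumberField IsDedekindDomain IsDedekindDomain.HeightOneSpectrum Field WithZero
open scoped nonZeroDivisors Classical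

namespace Literature.NumberTheory.NumberFields

open Literature.NumberTheory.GaloisRepresentations
open Literature.NumberTheory.GaloisRepresentations.ArtinLocalGlobal
open Literature.NumberTheory.LFunctions.AbelianDensity (artinSymbol artinSymbol_mul artinSymbol_asIdeal)
open Literature.RingTheory.DedekindDomain
open ValuativeRel

variable {K : Type} [Field K] [NumberField K] {𝔤 : Ideal (𝓞 K)} {v v' : HeightOneSpectrum (𝓞 K)}

/-! ### §0. Bookkeeping: `Frob_v^f = ((α), ·)` for `(α) = 𝔭_v^f`; restriction of Frobenius orders -/

omit [NumberField K] in
/-- `((τ|_L) x : K̄) = τ • x`. [folklore] -/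
private theorem coe_absRestrictNormalHom_apply₁₈ (L : IntermediateField K (AlgebraicClosure K)) [Normal K L]
    (τ : absoluteGaloisGroup K) (x : L) :
    ((absRestrictNormalHom L τ x : L) : AlgebraicClosure K) = τ • (x : AlgebraicClosure K) :=
  AlgEquiv.restrictNormalHom_apply L _ x

omit [NumberField K] in
/-- `res_L ρ = 1` iff `ρ` fixes `L` pointwise. [folklore] -/
private theorem absRestrictNormalHom_eq_one_iff_forall_smul_eq₁₈ (L : IntermediateField K (AlgebraicClosure K)) [Normal K L]
    (ρ : absoluteGaloisGroup K) : absRestrictNormalHom L ρ = 1 ↔ ∀ x ∈ L, ρ • x = x := by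
  constructor
  · intro h x hx
    have e := congrArg (fun σ : L ≃ₐ[K] L ↦ ((σ ⟨x, hx⟩ : L) : AlgebraicClosure K)) h
    simpa only [coe_absRestrictNormalHom_apply₁₈, AlgEquiv.one_apply] using e
  · intro h
    ext x
    rw [coe_absRestrictNormalHom_apply₁₈, AlgEquiv.one_apply]
    exact h x x.2

/-- `(α)` as a unit of fractional ideals: `toPrincipalIdeal (α) = mk0 ↑(span {α})`. [folklore] -/
private theorem toPrincipalIdeal_mk0_eq_unitsMk0_coeIdeal_span₁₈ {α : 𝓞 K} (hα0 : α ≠ 0) (hαK : (α : K) ≠ 0) :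
    toPrincipalIdeal (𝓞 K) K (Units.mk0 (α : K) hαK) =
      Units.mk0 ((Ideal.span {α} : Ideal (𝓞 K)) : FractionalIdeal (𝓞 K)⁰ K)
        (FractionalIdeal.coeIdeal_ne_zero.mpr (by rwa [Ne, Ideal.span_singleton_eq_bot])) := by
  ext1
  rw [coe_toPrincipalIdeal, Units.val_mk0, Units.val_mk0, FractionalIdeal.coeIdeal_span_singleton]

/-- `(Frob_v)^f = artinSymbol (𝔭_v^f)` (multiplicativity of the Artin symbol). [cite: NeukirchANT1999, Ch. VI §7 Thm. (7.1)] -/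
theorem artinSymbol_asIdeal_pow {G : Type*} [CommGroup G] (φ : HeightOneSpectrum (𝓞 K) → G) (f : ℕ) :
    artinSymbol φ (v.asIdeal ^ f) = φ v ^ f := by
  induction f with
  | zero =>
    rw [pow_zero, pow_zero, Ideal.one_eq_top]
    have h := artinSymbol_mul φ (I := ⊤) (J := ⊤) (by simp) (by simp)
    rw [Ideal.top_mul] at h
    exact mul_left_cancel (h.symm.trans (mul_one _).symm)
  | succ f ih => rw [pow_succ, artinSymbol_mul φ (pow_ne_zero _ v.ne_bot) v.ne_bot, ih, artinSymbol_asIdeal, pow_succ]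

/-- `¬ 𝔤v'^n ≤ v` for `v ∤ 𝔤`, `v ≠ v'`. [cite: deShalit1987, II.4.14 (p. 71)] -/
private theorem not_mul_pow_le₁₈ (hv : ¬ 𝔤 ≤ v.asIdeal) (hvv' : v' ≠ v) (n : ℕ) : ¬ 𝔤 * v'.asIdeal ^ n ≤ v.asIdeal := by
  intro h
  rcases (v.isPrime.mul_le).mp h with h1 | h2
  · exact hv h1
  · rcases n with _ | n
    · rw [pow_zero, Ideal.one_eq_top, top_le_iff] at h2
      exact v.isPrime.ne_top h2
    · exact hvv' (HeightOneSpectrum.ext ((v'.isMaximal.eq_of_le v.isPrime.ne_top ((Ideal.IsPrime.pow_le_iff (hP := v.isPrime)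
        (Nat.succ_ne_zero n)).mp h2))))

/-- A prime not containing `𝔪` is coprime to it. [folklore] -/
private theorem isCoprime_asIdeal_of_not_le₁₈ {𝔪 : Ideal (𝓞 K)} (h : ¬ 𝔪 ≤ v.asIdeal) : IsCoprime v.asIdeal 𝔪 := by
  rw [Ideal.isCoprime_iff_sup_eq]
  exact v.isMaximal.out.2 _ (lt_of_le_of_ne le_sup_left fun e ↦ h (e ▸ le_sup_right))

/-- ★ **Frobenius orders are compatible with restriction**: for `K(𝔪₁) ≤ K(𝔪₂)` (`v ∤ 𝔪₁𝔪₂`),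
`ord Frob_v(K(𝔪₁)/K) ∣ ord Frob_v(K(𝔪₂)/K)` — one global Artin element of `𝔭_v` restricts to both Frobenii.
[cite: NeukirchANT1999, Ch. VI §7 Thm. (7.1), Cor. (7.3)] -/
theorem orderOf_galFrob_dvd_of_le {𝔪₁ 𝔪₂ : Ideal (𝓞 K)} (h₁ : 𝔪₁ ≠ ⊥) (h₂ : 𝔪₂ ≠ ⊥) (hv₁ : ¬ 𝔪₁ ≤ v.asIdeal) (hv₂ : ¬ 𝔪₂ ≤ v.asIdeal)
    (hle : rayClassField K 𝔪₁ ≤ rayClassField K 𝔪₂) :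
    orderOf (galFrob K (rayClassField K 𝔪₁) v) ∣ orderOf (galFrob K (rayClassField K 𝔪₂) v) := by
  obtain ⟨σ, hσ⟩ := exists_forall_absRestrictNormalHom_eq_artinHom (K := K)
    (Units.mk0 (v.asIdeal : FractionalIdeal (𝓞 K)⁰ K) (coeIdeal_ne_zero_of_ne_bot v.ne_bot))
  have hres : ∀ {𝔪 : Ideal (𝓞 K)}, 𝔪 ≠ ⊥ → ¬ 𝔪 ≤ v.asIdeal →
      absRestrictNormalHom (rayClassField K 𝔪) σ = galFrob K (rayClassField K 𝔪) v := fun {𝔪} h𝔪 hv𝔪 ↦ by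
    rw [hσ 𝔪 h𝔪 (unitsMk0_coeIdeal_mem_idealsPrimeTo h𝔪 v.ne_bot (isCoprime_asIdeal_of_not_le₁₈ hv𝔪)),
      artinHom_unitsMk0_coeIdeal _ v.ne_bot, artinSymbol_asIdeal]
  refine orderOf_dvd_of_pow_eq_one ?_
  rw [← hres h₁ hv₁, ← map_pow, absRestrictNormalHom_eq_one_iff_forall_smul_eq₁₈]
  have h2 : absRestrictNormalHom (rayClassField K 𝔪₂) (σ ^ orderOf (galFrob K (rayClassField K 𝔪₂) v)) = 1 := by
    rw [map_pow, hres h₂ hv₂, pow_orderOf_eq_one]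
  rw [absRestrictNormalHom_eq_one_iff_forall_smul_eq₁₈] at h2
  exact fun x hx ↦ h2 x (hle hx)

variable [IsTotallyComplex K]
  (h𝔤0 : 𝔤 ≠ ⊥) (hv : ¬ 𝔤 ≤ v.asIdeal) (hv' : ¬ 𝔤 ≤ v'.asIdeal) (hvv' : v' ≠ v)
  (hw𝔤 : ∀ u : (𝓞 K)ˣ, (u : 𝓞 K) - 1 ∈ 𝔤 → u = 1)
  {p : ℕ} (hp : p.Prime) (hpv' : (p : 𝓞 K) ∈ v'.asIdeal) (hpv'2 : (p : 𝓞 K) ∉ v'.asIdeal ^ 2)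
  {α : 𝓞 K} (hα0 : α ≠ 0) (hα𝔤 : α - 1 ∈ 𝔤) {f : ℕ} (hαf : Ideal.span {α} = v.asIdeal ^ f)
  {m : ℕ} (hm : 1 ≤ m) (hm2 : 2 ≤ m ∨ p ≠ 2) (hαm : v'.intValuation (α - 1) = exp (-(m : ℤ)))

/-! ### §1. `Frob_v^{f·j} = ((α^j), ·)` and the growth of the Frobenius order -/

omit [IsTotallyComplex K] in
include hα0 hαf in
/-- **`Frob_v^{f·j} = ((α^j), K(𝔪)/K)`** for `(α) = 𝔭_v^f` (as `artinHom` of the principal fractional ideal `(α^j)`).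
[cite: NeukirchANT1999, Ch. VI §7 Thm. (7.1)] [cite: deShalit1987, II.1.10 (p. 39)] -/
theorem galFrob_pow_mul_eq_artinHom_pow (𝔪 : Ideal (𝓞 K)) (j : ℕ) :
    galFrob K (rayClassField K 𝔪) v ^ (f * j) =
      artinHom (galFrob K (rayClassField K 𝔪))
        (toPrincipalIdeal (𝓞 K) K (Units.mk0 ((α ^ j : 𝓞 K) : K) (by exact_mod_cast pow_ne_zero j hα0))) := by
  rw [toPrincipalIdeal_mk0_eq_unitsMk0_coeIdeal_span₁₈ (pow_ne_zero j hα0), artinHom_unitsMk0_coeIdeal _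
      (by rw [Ne, Ideal.span_singleton_eq_bot]; exact pow_ne_zero j hα0),
    ← Ideal.span_singleton_pow, hαf, ← pow_mul, artinSymbol_asIdeal_pow]

include h𝔤0 hv' hw𝔤 hp hpv' hpv'2 hα0 hα𝔤 hαf hm hm2 hαm in
/-- ★★ **`Frob_v^j = 1` on `K(𝔤v'^n)`, `n ≥ m`, forces `p^{n−m} ∣ j`**: `Frob^{fj} = ((α^j), K(𝔤v'^n)/K) = 1 ⟺ α^j ≡ 1 mod v'^n`
(`w_𝔤 = 1`) ⟺ `p^{n−m} ∣ j` (lifting the exponent at the absolutely unramified `v'`).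
[cite: deShalit1987, II.1.9 (p. 43), II.4.17 (p. 78)] [cite: Serre1973CourseArithmetic, Ch. II §3.1] [cite: NeukirchANT1999, Ch. VI §7 Thm. (7.1)] -/
theorem pow_prime_dvd_of_galFrob_pow_eq_one {n : ℕ} (hn : m ≤ n) {j : ℕ}
    (hj : galFrob K (rayClassField K (𝔤 * v'.asIdeal ^ n)) v ^ j = 1) : p ^ (n - m) ∣ j := by
  rcases eq_or_ne j 0 with rfl | hj0
  · exact dvd_zero _
  have hαv' : α ∉ v'.asIdeal := by
    intro h
    have h1 : v'.intValuation (α - 1) < 1 := by rw [hαm, ← exp_zero, exp_lt_exp]; omega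
    rw [intValuation_lt_one_iff_mem] at h1
    exact v'.isPrime.ne_top ((Ideal.eq_top_iff_one _).mpr (by simpa using v'.asIdeal.sub_mem h h1))
  -- `((α^j), K(𝔤v'^n)/K) = 1`
  have h1 : artinHom (galFrob K (rayClassField K (𝔤 * v'.asIdeal ^ n)))
      (toPrincipalIdeal (𝓞 K) K (Units.mk0 ((α ^ j : 𝓞 K) : K) (by exact_mod_cast pow_ne_zero j hα0))) = 1 := by
    rw [← galFrob_pow_mul_eq_artinHom_pow hα0 hαf, pow_mul', hj, one_pow]
  -- hence `α^j ≡ 1 mod v'^n`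
  have hαj𝔤 : α ^ j - 1 ∈ 𝔤 := by
    rw [← geom_sum_mul α j]
    exact Ideal.mul_mem_left _ _ hα𝔤
  have hαjv' : α ^ j ∉ v'.asIdeal := fun h ↦ hαv' (v'.isPrime.mem_of_pow_mem j h)
  have h2 := (artinHom_toPrincipalIdeal_rayClassField_mul_pow_eq_one_iff h𝔤0 hv' hw𝔤 (pow_ne_zero j hα0) hαj𝔤 hαjv' n).mp h1
  -- lifting the exponent
  rw [← Nat.add_sub_cancel' hn] at h2
  exact (pow_sub_one_mem_pow_iff v' hp hpv' hpv'2 hm hm2 hαm hj0 (n - m)).mp h2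

include h𝔤0 hv' hw𝔤 hp hpv' hpv'2 hα0 hα𝔤 hαf hm hm2 hαm in
/-- ★★ **`p^{n−m} ∣ ord Frob_v(K(𝔤v'^n)/K)`** for `n ≥ m`. [cite: deShalit1987, II.1.9 (p. 43), II.4.14 (p. 71)]
[cite: Serre1973CourseArithmetic, Ch. II §3.1] -/
theorem pow_prime_dvd_orderOf_galFrob {n : ℕ} (hn : m ≤ n) :
    p ^ (n - m) ∣ orderOf (galFrob K (rayClassField K (𝔤 * v'.asIdeal ^ n)) v) :=
  pow_prime_dvd_of_galFrob_pow_eq_one h𝔤0 hv' hw𝔤 hp hpv' hpv'2 hα0 hα𝔤 hαf hm hm2 hαm hn (pow_orderOf_eq_one _)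

include h𝔤0 hv hv' hvv' hw𝔤 hp hpv' hpv'2 hα0 hα𝔤 hαf hm hm2 hαm in
/-- ★★ **`d·p^{n−m} ∣ ord Frob_v(K(𝔤v'^n)/K)`** for `n ≥ m` and any prime-to-`p` divisor `d` of `ord Frob_v(K(𝔤)/K)` (the residue
degree of `v` in `K(𝔤)`). [cite: deShalit1987, II.1.9 (p. 43), II.4.14 (p. 71)] [cite: NeukirchANT1999, Ch. VI §7 Cor. (7.3)] -/
theorem mul_pow_prime_dvd_orderOf_galFrob {d : ℕ} (hd : d.Coprime p) (hdvd : d ∣ orderOf (galFrob K (rayClassField K 𝔤) v))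
    {n : ℕ} (hn : m ≤ n) :
    d * p ^ (n - m) ∣ orderOf (galFrob K (rayClassField K (𝔤 * v'.asIdeal ^ n)) v) :=
  Nat.Coprime.mul_dvd_of_dvd_of_dvd (hd.pow_right _)
    (hdvd.trans (orderOf_galFrob_dvd_of_le h𝔤0 (mul_ne_zero h𝔤0 (pow_ne_zero _ v'.ne_bot)) hv (not_mul_pow_le₁₈ hv hvv' n)
      (rayClassField_le_of_le (mul_ne_zero h𝔤0 (pow_ne_zero _ v'.ne_bot)) Ideal.mul_le_right)))
    (pow_prime_dvd_orderOf_galFrob h𝔤0 hv' hw𝔤 hp hpv' hpv'2 hα0 hα𝔤 hαf hm hm2 hαm hn)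

include h𝔤0 hv hv' hvv' hw𝔤 hp hpv' hpv'2 hα0 hα𝔤 hαf hm hm2 hαm in
/-- ★★ **The idelic form consumed by the INERT criterion**: for a uniformiser `π` of `K_v`,
`d·p^{n−m} ∣ ord [⟨π⟩_v, K]|_{K(𝔤v'^n)}` (`[⟨π⟩_v, K]|_{K(𝔪)} = Frob_v`, `abRestrict_ideleArtinMap_rayClassField_localUnits`); feed it to
`mem_fixingSubgroup_of_forall_smul_absClosureEmbedding_eq_of_finrank_dvd_orderOf` with `[E':K_v] = d·p^{n−m}`.
[cite: deShalit1987, II.1.10 (p. 39), II.4.14 (p. 71)] [cite: NeukirchANT1999, Ch. VI §7 Thm. (7.1)] -/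
theorem mul_pow_prime_dvd_orderOf_frob_idelic {d : ℕ} (hd : d.Coprime p) (hdvd : d ∣ orderOf (galFrob K (rayClassField K 𝔤) v))
    {n : ℕ} (hn : m ≤ n) {π : 𝒪[v.adicCompletion K]} (hπ : (valuation (v.adicCompletion K)).IsUniformizer (π : v.adicCompletion K)) :
    ((d * p ^ (n - m) : ℕ) : ℤ) ∣ (orderOf (abRestrict (rayClassField K (𝔤 * v'.asIdeal ^ n))
      (ideleArtinMap K (localUnits v (Units.mk0 (π : v.adicCompletion K) hπ.ne_zero)))) : ℤ) := by
  rw [abRestrict_ideleArtinMap_rayClassField_localUnits (mul_ne_zero h𝔤0 (pow_ne_zero _ v'.ne_bot)) (not_mul_pow_le₁₈ hv hvv' n)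
    (valued_eq_exp_neg_one_of_isUniformizer (hx := hπ))]
  exact_mod_cast mul_pow_prime_dvd_orderOf_galFrob h𝔤0 hv hv' hvv' hw𝔤 hp hpv' hpv'2 hα0 hα𝔤 hαf hm hm2 hαm hd hdvd hn

/-! ### §2. The sharp form: `α` of level `ℓ ≥ 1`, `α^p` of exact level `m` ⟹ `p^{n−m+1} ∣ j` (covers `p = 2`, `ℓ = 1`) -/

include h𝔤0 hv' hw𝔤 hp hpv' hpv'2 hα0 hα𝔤 hαf in
/-- ★★ **Sharp growth** — for `α` as above but of ANY level `ℓ ≥ 1` at `v'` (`v'(α − 1) = ℓ`; at `p = 2`, `ℓ = 1` Serre's lemma does not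
apply to `α` itself) whose `p`-th power has exact level `m` (`m ≥ 2` or `p ≠ 2`; automatically `m ≥ ℓ + 1`): `Frob_v^j = 1` on `K(𝔤v'^n)`,
`n ≥ m`, forces **`p^{n−m+1} ∣ j`** — exponents prime to `p` keep the level `ℓ < n` (`intValuation_pow_sub_one_of_not_dvd`), so `p ∣ j`, and
`(α^p)^{j/p} ≡ 1 mod v'^n` gives `p^{n−m} ∣ j/p`.  (For `K = ℚ(√−7)`, `v' = 𝔭̄ ∣ 2`: `α = π³ ≡ 3 mod 8` has `ℓ = 1`, `α² ≡ 9 mod 16` has `m = 3`,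
whence `ord Frob ≥ 3·2^{n−2}` on `K(𝔣𝔭̄^n)`.) [cite: deShalit1987, II.1.9 (p. 43), II.4.17 (p. 78)] [cite: Serre1973CourseArithmetic, Ch. II §3.1] -/
theorem pow_prime_dvd_of_galFrob_pow_eq_one_of_pow_level {ℓ m : ℕ} (hℓ : 1 ≤ ℓ) (hαℓ : v'.intValuation (α - 1) = exp (-(ℓ : ℤ)))
    (hm2 : 2 ≤ m ∨ p ≠ 2) (hαm : v'.intValuation (α ^ p - 1) = exp (-(m : ℤ))) {n : ℕ} (hn : m ≤ n) {j : ℕ}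
    (hj : galFrob K (rayClassField K (𝔤 * v'.asIdeal ^ n)) v ^ j = 1) : p ^ (n - m + 1) ∣ j := by
  haveI := Fact.mk hp
  rcases eq_or_ne j 0 with rfl | hj0
  · exact dvd_zero _
  have hαv' : α ∉ v'.asIdeal := by
    intro h
    have h1 : v'.intValuation (α - 1) < 1 := by rw [hαℓ, ← exp_zero, exp_lt_exp]; omega
    rw [intValuation_lt_one_iff_mem] at h1
    exact v'.isPrime.ne_top ((Ideal.eq_top_iff_one _).mpr (by simpa using v'.asIdeal.sub_mem h h1))
  -- `m ≥ ℓ + 1`: `α^p − 1 = (α − 1)·(1 + α + ⋯ + α^{p−1})` and the cofactor is `≡ p ≡ 0 mod v'`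
  have hmℓ : ℓ + 1 ≤ m := by
    have hx1 : α - 1 ∈ v'.asIdeal := by
      rw [← intValuation_lt_one_iff_mem, hαℓ, ← exp_zero, exp_lt_exp]; omega
    have hS : (∑ i ∈ Finset.range p, α ^ i) ∈ v'.asIdeal := by
      have e : (∑ i ∈ Finset.range p, α ^ i) = (∑ i ∈ Finset.range p, (α ^ i - 1)) + (p : 𝓞 K) := by
        rw [Finset.sum_sub_distrib, Finset.sum_const, Finset.card_range, nsmul_eq_mul, mul_one, sub_add_cancel]
      rw [e]
      refine v'.asIdeal.add_mem (Ideal.sum_mem _ fun i _ ↦ ?_) hpv'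
      rw [← geom_sum_mul α i]
      exact Ideal.mul_mem_left _ _ hx1
    have hval : v'.intValuation (α ^ p - 1) ≤ exp (-((ℓ + 1 : ℕ) : ℤ)) := by
      have hS' : v'.intValuation (∑ i ∈ Finset.range p, α ^ i) ≤ exp (-((1 : ℕ) : ℤ)) :=
        (v'.intValuation_le_pow_iff_mem _ 1).mpr (by rwa [pow_one])
      rw [← geom_sum_mul α p, map_mul, hαℓ]
      calc v'.intValuation (∑ i ∈ Finset.range p, α ^ i) * exp (-(ℓ : ℤ)) ≤ exp (-((1 : ℕ) : ℤ)) * exp (-(ℓ : ℤ)) := by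
            gcongr
        _ = exp (-((ℓ + 1 : ℕ) : ℤ)) := by rw [← exp_add]; congr 1; push_cast; ring
    rw [hαm, exp_le_exp] at hval
    omega
  have hm : 1 ≤ m := by omega
  -- `((α^j), K(𝔤v'^n)/K) = 1`, so `α^j ≡ 1 mod v'^n`
  have h1 : artinHom (galFrob K (rayClassField K (𝔤 * v'.asIdeal ^ n)))
      (toPrincipalIdeal (𝓞 K) K (Units.mk0 ((α ^ j : 𝓞 K) : K) (by exact_mod_cast pow_ne_zero j hα0))) = 1 := by
    rw [← galFrob_pow_mul_eq_artinHom_pow hα0 hαf, pow_mul', hj, one_pow]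
  have hαj𝔤 : α ^ j - 1 ∈ 𝔤 := by
    rw [← geom_sum_mul α j]
    exact Ideal.mul_mem_left _ _ hα𝔤
  have hαjv' : α ^ j ∉ v'.asIdeal := fun h ↦ hαv' (v'.isPrime.mem_of_pow_mem j h)
  have h2 := (artinHom_toPrincipalIdeal_rayClassField_mul_pow_eq_one_iff h𝔤0 hv' hw𝔤 (pow_ne_zero j hα0) hαj𝔤 hαjv' n).mp h1
  -- `p ∣ j`: otherwise `α^j` has level `ℓ < n`
  have hpj : p ∣ j := by
    by_contra hpj
    have hlev := intValuation_pow_sub_one_of_not_dvd v' hp hpv' hℓ hαℓ hpj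
    rw [← intValuation_le_pow_iff_mem, hlev, exp_le_exp] at h2
    omega
  obtain ⟨j', rfl⟩ := hpj
  have hj'0 : j' ≠ 0 := by rintro rfl; exact hj0 (mul_zero p)
  rw [pow_mul, ← Nat.add_sub_cancel' hn] at h2
  have h3 := (pow_sub_one_mem_pow_iff v' hp hpv' hpv'2 hm hm2 hαm hj'0 (n - m)).mp h2
  rw [pow_succ, mul_comm]
  exact mul_dvd_mul_left p h3

include h𝔤0 hv hv' hvv' hw𝔤 hp hpv' hpv'2 hα0 hα𝔤 hαf in
/-- ★★ **Sharp form: `d·p^{n−m+1} ∣ ord Frob_v(K(𝔤v'^n)/K)`** for `n ≥ m`, `α` of level `ℓ ≥ 1` with `α^p` of exact level `m`, and a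
prime-to-`p` divisor `d` of `ord Frob_v(K(𝔤)/K)`. [cite: deShalit1987, II.1.9 (p. 43), II.4.14 (p. 71)] [cite: Serre1973CourseArithmetic, Ch. II §3.1] -/
theorem mul_pow_prime_succ_dvd_orderOf_galFrob_of_pow_level {ℓ m : ℕ} (hℓ : 1 ≤ ℓ) (hαℓ : v'.intValuation (α - 1) = exp (-(ℓ : ℤ)))
    (hm2 : 2 ≤ m ∨ p ≠ 2) (hαm : v'.intValuation (α ^ p - 1) = exp (-(m : ℤ))) {d : ℕ} (hd : d.Coprime p)
    (hdvd : d ∣ orderOf (galFrob K (rayClassField K 𝔤) v)) {n : ℕ} (hn : m ≤ n) :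
    d * p ^ (n - m + 1) ∣ orderOf (galFrob K (rayClassField K (𝔤 * v'.asIdeal ^ n)) v) :=
  Nat.Coprime.mul_dvd_of_dvd_of_dvd (hd.pow_right _)
    (hdvd.trans (orderOf_galFrob_dvd_of_le h𝔤0 (mul_ne_zero h𝔤0 (pow_ne_zero _ v'.ne_bot)) hv (not_mul_pow_le₁₈ hv hvv' n)
      (rayClassField_le_of_le (mul_ne_zero h𝔤0 (pow_ne_zero _ v'.ne_bot)) Ideal.mul_le_right)))
    (pow_prime_dvd_of_galFrob_pow_eq_one_of_pow_level h𝔤0 hv' hw𝔤 hp hpv' hpv'2 hα0 hα𝔤 hαf hℓ hαℓ hm2 hαm hn (pow_orderOf_eq_one _))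

include h𝔤0 hv hv' hvv' hw𝔤 hp hpv' hpv'2 hα0 hα𝔤 hαf in
/-- ★★ **Sharp idelic form** (input of the INERT criterion with `[E':K_v] = d·p^{n−m+1}`).
[cite: deShalit1987, II.1.10 (p. 39), II.4.14 (p. 71)] [cite: NeukirchANT1999, Ch. VI §7 Thm. (7.1)] -/
theorem mul_pow_prime_succ_dvd_orderOf_frob_idelic_of_pow_level {ℓ m : ℕ} (hℓ : 1 ≤ ℓ)
    (hαℓ : v'.intValuation (α - 1) = exp (-(ℓ : ℤ))) (hm2 : 2 ≤ m ∨ p ≠ 2) (hαm : v'.intValuation (α ^ p - 1) = exp (-(m : ℤ)))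
    {d : ℕ} (hd : d.Coprime p) (hdvd : d ∣ orderOf (galFrob K (rayClassField K 𝔤) v)) {n : ℕ} (hn : m ≤ n)
    {π : 𝒪[v.adicCompletion K]} (hπ : (valuation (v.adicCompletion K)).IsUniformizer (π : v.adicCompletion K)) :
    ((d * p ^ (n - m + 1) : ℕ) : ℤ) ∣ (orderOf (abRestrict (rayClassField K (𝔤 * v'.asIdeal ^ n))
      (ideleArtinMap K (localUnits v (Units.mk0 (π : v.adicCompletion K) hπ.ne_zero)))) : ℤ) := by
  rw [abRestrict_ideleArtinMap_rayClassField_localUnits (mul_ne_zero h𝔤0 (pow_ne_zero _ v'.ne_bot)) (not_mul_pow_le₁₈ hv hvv' n)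
    (valued_eq_exp_neg_one_of_isUniformizer (hx := hπ))]
  exact_mod_cast mul_pow_prime_succ_dvd_orderOf_galFrob_of_pow_level h𝔤0 hv hv' hvv' hw𝔤 hp hpv' hpv'2 hα0 hα𝔤 hαf hℓ hαℓ hm2 hαm hd
    hdvd hn

end Literature.NumberTheory.NumberFields

end
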